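import Summits.Ventures.PercRepro2.CaseOneThickening

/-!
# Deleting a loop: every case-1 quantity is unchanged
(blind cell PercRepro2, p1 g22; the fourth, one-line transfer — ref-2's remark o₂ on S5 v41: `Sym2`
admits diagonal ends, and a loop never changes a connection)

A loop `e₀` (`ends e₀ = s(x, x)`) contributes no adjacency to the open graph (`openGraph_adj` asks for
distinct ends), so the open graph of `ω` is the open graph of the restriction to `E − e₀`
(`openGraph_loop`), every connection event is a preimage under `restrictCfg e₀` (`connEvent_loop`), and
the product law pushes forward by `prob_restrict` (CaseOneLeafDelete — the factor of the deleted edge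
sums to one, whatever its weight). Hence every case-1 quantity at every vertex is unchanged
(`iiExpr_loop`, …), the four Props transfer in both directions (`zSplitII_loop_iff`, …), and the
four-forms-for-all-weights property survives adding a loop anywhere (`fourFormsAll_of_loop`). With the
leaf, parallel and series transfers: a residual graph may be taken loopless as well. Own code;
standard axioms. -/

namespace Summit.Ventures.PercRepro2

namespace CaseOne

/-! ## A loop contributes no connection -/

section LoopConn
variable {V : Type*} {E : Type*} {ends : E → Sym2 V} {e₀ : E}

/-- A loop is not an edge between two distinct vertices. -/
lemma ne_of_loop {x : V} (hl : ends e₀ = s(x, x)) {u v : V} (huv : u ≠ v) {e : E}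
    (he : ends e = s(u, v)) : e ≠ e₀ := by
  rintro rfl
  rw [hl, Sym2.eq_iff] at he
  rcases he with ⟨h1, h2⟩ | ⟨h1, h2⟩
  · exact huv (h1.symm.trans h2)
  · exact huv (h2.symm.trans h1)

/-- The open graph ignores a loop. -/
lemma openGraph_loop {x : V} (hl : ends e₀ = s(x, x)) (ω : Config E) :
    openGraph ends ω = openGraph (restrictEnds ends e₀) (restrictCfg e₀ ω) := by
  ext u v
  rw [openGraph_adj, openGraph_adj]
  constructor
  · rintro ⟨huv, e, he, hends⟩
    exact ⟨huv, ⟨e, ne_of_loop hl huv hends⟩, he, hends⟩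
  · rintro ⟨huv, ⟨e, _⟩, he, hends⟩
    exact ⟨huv, e, he, hends⟩

/-- **Connections ignore a loop.** -/
lemma conn_loop_iff {x : V} (hl : ends e₀ = s(x, x)) (ω : Config E) {u v : V} :
    Conn ends ω u v ↔ Conn (restrictEnds ends e₀) (restrictCfg e₀ ω) u v := by
  unfold Conn
  rw [openGraph_loop hl ω]

/-- The connection event is the preimage of the connection event of `G − e₀` under the restriction. -/
theorem connEvent_loop {x : V} (hl : ends e₀ = s(x, x)) (u v : V) :
    connEvent ends u v = restrictCfg e₀ ⁻¹' connEvent (restrictEnds ends e₀) u v := by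
  ext ω
  simp only [mem_connEvent, Set.mem_preimage]
  exact conn_loop_iff hl ω

end LoopConn

/-! ## The case-1 quantities -/

section Transfer
variable {V : Type*} {E : Type*} [Fintype E] [DecidableEq E] {R : Type*} [CommRing R]
variable {ends : E → Sym2 V} {o a₁ a₂ v b x : V} {e₀ : E}

/-- `D` is unchanged by deleting a loop. -/
theorem Dpd_loop (p : E → R) (hl : ends e₀ = s(x, x)) :
    Dpd p ends a₁ a₂ v = Dpd (restrictW p e₀) (restrictEnds ends e₀) a₁ a₂ v := by
  unfold Dpd
  simp only [connEvent_loop hl, ← Set.preimage_compl, ← Set.preimage_inter, prob_restrict]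

/-- `D_o` is unchanged by deleting a loop. -/
theorem Dpdo_loop (p : E → R) (hl : ends e₀ = s(x, x)) :
    Dpdo p ends o a₁ a₂ v = Dpdo (restrictW p e₀) (restrictEnds ends e₀) o a₁ a₂ v := by
  unfold Dpdo
  simp only [connEvent_loop hl, ← Set.preimage_compl, ← Set.preimage_inter, ← Set.preimage_union,
    prob_restrict]

/-- `P(Q, o ∈ U)` is unchanged by deleting a loop. -/
theorem Dqo_loop (p : E → R) (hl : ends e₀ = s(x, x)) :
    Dqo p ends o a₁ a₂ = Dqo (restrictW p e₀) (restrictEnds ends e₀) o a₁ a₂ := by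
  unfold Dqo
  simp only [connEvent_loop hl, ← Set.preimage_compl, ← Set.preimage_inter, ← Set.preimage_union,
    prob_restrict]

/-- `P(Q)` is unchanged by deleting a loop. -/
theorem probQ_loop (p : E → R) (hl : ends e₀ = s(x, x)) :
    prob p (connEvent ends a₁ a₂)ᶜ =
      prob (restrictW p e₀) (connEvent (restrictEnds ends e₀) a₁ a₂)ᶜ := by
  rw [connEvent_loop hl, ← Set.preimage_compl, prob_restrict]

/-- **`iiExpr` is unchanged by deleting a loop.** -/
theorem iiExpr_loop (p : E → R) (hl : ends e₀ = s(x, x)) :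
    iiExpr p ends o a₁ a₂ v b = iiExpr (restrictW p e₀) (restrictEnds ends e₀) o a₁ a₂ v b := by
  rw [iiExpr_eq_probs, iiExpr_eq_probs, Dpd_loop p hl, Dpdo_loop p hl]
  simp only [connEvent_loop hl, ← Set.preimage_compl, ← Set.preimage_inter, prob_restrict]

/-- **`iExpr` is unchanged by deleting a loop.** -/
theorem iExpr_loop (p : E → R) (hl : ends e₀ = s(x, x)) :
    iExpr p ends o a₁ a₂ v b = iExpr (restrictW p e₀) (restrictEnds ends e₀) o a₁ a₂ v b := by
  rw [iExpr_eq_iExprT, iExpr_eq_iExprT, iExprT_eq, iExprT_eq, Dpd_loop p hl, Dpdo_loop p hl]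
  simp only [connEvent_loop hl, ← Set.preimage_compl, ← Set.preimage_inter, prob_restrict]

/-- **`iiExprT` is unchanged by deleting a loop** (any threshold pair). -/
theorem iiExprT_loop (p : E → R) (hl : ends e₀ = s(x, x)) (c₀ c₁ : R) :
    iiExprT p ends o a₁ a₂ v b c₀ c₁ =
      iiExprT (restrictW p e₀) (restrictEnds ends e₀) o a₁ a₂ v b c₀ c₁ := by
  rw [iiExprT_eq, iiExprT_eq]
  simp only [connEvent_loop hl, ← Set.preimage_compl, ← Set.preimage_inter, prob_restrict]

/-- **`iExprT` is unchanged by deleting a loop** (any threshold pair). -/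
theorem iExprT_loop (p : E → R) (hl : ends e₀ = s(x, x)) (c₀ c₁ : R) :
    iExprT p ends o a₁ a₂ v b c₀ c₁ =
      iExprT (restrictW p e₀) (restrictEnds ends e₀) o a₁ a₂ v b c₀ c₁ := by
  rw [iExprT_eq, iExprT_eq]
  simp only [connEvent_loop hl, ← Set.preimage_compl, ← Set.preimage_inter, prob_restrict]

end Transfer

/-! ## The Props and the closed property -/

section Props
variable {V : Type*} {E : Type*} [Fintype E] [DecidableEq E] {R : Type*} [CommRing R] [LinearOrder R]
variable {ends : E → Sym2 V} {o a₁ a₂ v b x : V} {e₀ : E}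

/-- `(ii)` in `G` iff `(ii)` in `G − e₀`, for a loop `e₀`. -/
theorem zSplitII_loop_iff (p : E → R) (hl : ends e₀ = s(x, x)) :
    ZSplitII p ends o a₁ a₂ v b ↔ ZSplitII (restrictW p e₀) (restrictEnds ends e₀) o a₁ a₂ v b := by
  unfold ZSplitII
  rw [iiExpr_loop p hl]

/-- `(i)` in `G` iff `(i)` in `G − e₀`, for a loop `e₀`. -/
theorem zSplitI_loop_iff (p : E → R) (hl : ends e₀ = s(x, x)) :
    ZSplitI p ends o a₁ a₂ v b ↔ ZSplitI (restrictW p e₀) (restrictEnds ends e₀) o a₁ a₂ v b := by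
  unfold ZSplitI
  rw [iExpr_loop p hl]

/-- `(ii-Q)` in `G` iff `(ii-Q)` in `G − e₀`, for a loop `e₀`. -/
theorem zSplitIIQ_loop_iff (p : E → R) (hl : ends e₀ = s(x, x)) :
    ZSplitIIQ p ends o a₁ a₂ v b ↔ ZSplitIIQ (restrictW p e₀) (restrictEnds ends e₀) o a₁ a₂ v b := by
  unfold ZSplitIIQ
  rw [iiExprT_loop p hl, Dqo_loop p hl, probQ_loop p hl]

/-- `(i-Q)` in `G` iff `(i-Q)` in `G − e₀`, for a loop `e₀`. -/
theorem zSplitIQ_loop_iff (p : E → R) (hl : ends e₀ = s(x, x)) :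
    ZSplitIQ p ends o a₁ a₂ v b ↔ ZSplitIQ (restrictW p e₀) (restrictEnds ends e₀) o a₁ a₂ v b := by
  unfold ZSplitIQ
  rw [iExprT_loop p hl, Dqo_loop p hl, probQ_loop p hl]

/-- The four forms at `v` in `G − e₀` give the four forms at `v` in `G`, for a loop `e₀`. -/
theorem fourForms_of_loop (p : E → R) (hl : ends e₀ = s(x, x))
    (h : FourForms (restrictW p e₀) (restrictEnds ends e₀) o a₁ a₂ v b) :
    FourForms p ends o a₁ a₂ v b :=
  ⟨(zSplitII_loop_iff p hl).2 h.1, (zSplitIIQ_loop_iff p hl).2 h.2.1,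
    (zSplitI_loop_iff p hl).2 h.2.2.1, (zSplitIQ_loop_iff p hl).2 h.2.2.2⟩

variable (o a₁ a₂ b) [IsStrictOrderedRing R]

omit [Fintype E] [DecidableEq E] in
/-- **Adding a loop preserves the closed property**: if `v` has the four forms for every weight vector
in `G − e₀`, it has them for every weight vector in `G`, for a loop `e₀`. -/
theorem fourFormsAll_of_loop (hl : ends e₀ = s(x, x))
    (h : FourFormsAll R o a₁ a₂ b {e : E // e ≠ e₀} (restrictEnds ends e₀) v) :
    FourFormsAll R o a₁ a₂ b E ends v := by
  intro _ _ p hp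
  exact fourForms_of_loop p hl (h (restrictW p e₀) (IsProbVec.restrictW hp e₀))

end Props

end CaseOne

end Summit.Ventures.PercRepro2
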